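import Mathlib
import Summits.Ventures.PercRepro2.Defs
import Summits.Ventures.PercRepro2.Graph
import Summits.Ventures.PercRepro2.OneColourSwitch
import Summits.Ventures.PercRepro2.RegionHubSign
import Summits.Ventures.PercRepro2.SideSwitch
import Summits.Ventures.PercRepro2.SideSwitchFibre
import Summits.Ventures.PercRepro2.SideSwitchClosed
import Summits.Ventures.PercRepro2.SideSwitchComps
import Summits.Ventures.PercRepro2.SideSwitchCompsFibre
import Summits.Ventures.PercRepro2.M9NoPocketDefs
import Summits.Ventures.PercRepro2.M9NoPocketSetDefs

/-!
# The multi-`d` class without pockets — the worlds of `G − D` of an assignment (blind cell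
PercRepro2, p3 g20, 2026-08-27; `proofs/P3-CPNC.md` §17i (2))

The multi-`d` form of `M9NoPocketWorld`: for a representative `ρ` and a coordinate vector `x`
the worlds of `{r, s}` in `G − D` of `assignX x ρ` are the switched ones (`K2_endsD_assignX`,
`M2_endsD_assignX`), the assignment is `Sep` and `DZero` in `G − D`, the blocks are preserved,
and the values of the `T`-edges and of the edges from `D` to the blocks are as assigned.
Own work; std axioms.
-/

namespace Summit.Ventures.PercRepro2

namespace NoPocketSet

open Finset Classical RegionHub OneColourSwitch SideSwitch NoPocket

variable {V : Type*} {E : Type*}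

section Assign

variable [Fintype V] [DecidableEq V] [Fintype E] [DecidableEq E]

variable {ends : E → Sym2 V}

omit [Fintype V] [DecidableEq V] [Fintype E] [DecidableEq E] in
/-- An edge not at `D` touches a vertex set in `G` iff it touches it in `G − D`. -/
lemma mem_touches_endsD_iff {D : Finset V} {r : V} {S : Set V} {e : E} (he : ¬ AtD ends D e) :
    e ∈ touches (endsD ends D r) S ↔ e ∈ touches ends S := by
  simp only [mem_touches, endsD_of_not_atD he]

omit [Fintype V] in
/-- Off the edges at `D`, the assignment is the block switch of `G − D`. -/
lemma assignX_eq_flipTouch_endsD_of_not_atD {D : Finset V} {r s : V} {ρ : Config E}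
    {x : Finset (Finset V) × Finset E} (hF : x.2 ⊆ Tset ends D r s) {e : E}
    (he : ¬ AtD ends D e) :
    assignX ends x ρ e = flipTouch (endsD ends D r) (↑(unionT x.1) : Set V) ρ e := by
  simp only [assignX, flipTouch, mem_touches_endsD_iff he, flipF_Tset_of_not_atD hF he]

omit [Fintype V] in
/-- The `Y`-world of `{r, s}` in `G − D` of an assignment is that of the block switch. -/
lemma K2_endsD_assignX_eq {D : Finset V} {r s : V} {ρ : Config E}
    {x : Finset (Finset V) × Finset E} (hF : x.2 ⊆ Tset ends D r s) :
    K2 (endsD ends D r) r s (assignX ends x ρ) =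
      K2 (endsD ends D r) r s (flipTouch (endsD ends D r) (↑(unionT x.1) : Set V) ρ) :=
  K2_endsD_eq_of_eqOn (fun _ he => assignX_eq_flipTouch_endsD_of_not_atD hF he) s

omit [Fintype V] in
/-- The `W`-world of `{r, s}` in `G − D` of an assignment is that of the block switch. -/
lemma M2_endsD_assignX_eq {D : Finset V} {r s : V} {ρ : Config E}
    {x : Finset (Finset V) × Finset E} (hF : x.2 ⊆ Tset ends D r s) :
    M2 (endsD ends D r) r s (assignX ends x ρ) =
      M2 (endsD ends D r) r s (flipTouch (endsD ends D r) (↑(unionT x.1) : Set V) ρ) :=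
  M2_endsD_eq_of_eqOn (fun _ he => assignX_eq_flipTouch_endsD_of_not_atD hF he) s

omit [Fintype E] [DecidableEq E] in
/-- The switch data of a union of blocks. -/
lemma block_switch_data {D : Finset V} {r s : V} {ρ : Config E}
    {T : Finset (Finset V)} (hT : T ⊆ blocks ends D r s ρ) :
    (↑(unionT T) : Set V) ⊆ K2 (endsD ends D r) r s ρ ∪ M2 (endsD ends D r) r s ρ ∧
      r ∉ (↑(unionT T) : Set V) ∧ s ∉ (↑(unionT T) : Set V) ∧
      ClosedIn (endsD ends D r) (sided (endsD ends D r) r s ρ) (↑(unionT T) : Set V) :=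
  switch_data_unionT (ends := endsD ends D r) hT

/-- A representative is a representative of `G − D` in the sense of `SideSwitchFibre`. -/
lemma mem_Rep_endsD_of_mem_RepD {p q r s : V} {D : Finset V} {ρ : Config E}
    (hρ : ρ ∈ RepD ends p q r s D) : ρ ∈ Rep (endsD ends D r) p q r s := by
  obtain ⟨h1, h2, _⟩ := mem_RepD.1 hρ
  exact mem_Rep.2 ⟨h1, h2⟩

/-- For a representative every block vertex lies in the `Y`-world of `G − D`. -/
lemma unionT_subset_K2_endsD {p q r s : V} {D : Finset V} {ρ : Config E}
    (hρ : ρ ∈ RepD ends p q r s D) {T : Finset (Finset V)} (hT : T ⊆ blocks ends D r s ρ) :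
    (↑(unionT T) : Set V) ⊆ K2 (endsD ends D r) r s ρ := by
  intro y hy
  exact A0_subset_K2_of_mem_Rep (mem_Rep_endsD_of_mem_RepD hρ)
    (unionT_subset_A0 (ends := endsD ends D r) hT (Finset.mem_coe.1 hy))

/-- **The `Y`-world of `G − D` of an assignment**: the `Y`-world of the representative minus
the switched blocks. -/
lemma K2_endsD_assignX {p q r s : V} {D : Finset V} {ρ : Config E} (hρ : ρ ∈ RepD ends p q r s D)
    {x : Finset (Finset V) × Finset E} (hT : x.1 ⊆ blocks ends D r s ρ)
    (hF : x.2 ⊆ Tset ends D r s) :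
    K2 (endsD ends D r) r s (assignX ends x ρ) =
      K2 (endsD ends D r) r s ρ \ (↑(unionT x.1) : Set V) := by
  rw [K2_endsD_assignX_eq hF]
  obtain ⟨h1, h2, h3, h4⟩ := block_switch_data hT
  obtain ⟨hsep, hM, _⟩ := mem_RepD.1 hρ
  rw [K2_flipTouch_of_closed hsep h1 h2 h3 h4]
  ext y
  simp only [Set.mem_union, Set.mem_sdiff, Set.mem_inter_iff]
  constructor
  · rintro (h | ⟨hyT, hyM⟩)
    · exact h
    · rcases hM y hyM with rfl | rfl
      · exact (h2 hyT).elim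
      · exact (h3 hyT).elim
  · exact fun h => Or.inl h

/-- **The `W`-world of `G − D` of an assignment**: the switched blocks together with `r, s`. -/
lemma M2_endsD_assignX {p q r s : V} {D : Finset V} {ρ : Config E} (hρ : ρ ∈ RepD ends p q r s D)
    {x : Finset (Finset V) × Finset E} (hT : x.1 ⊆ blocks ends D r s ρ)
    (hF : x.2 ⊆ Tset ends D r s) :
    M2 (endsD ends D r) r s (assignX ends x ρ) =
      M2 (endsD ends D r) r s ρ ∪ (↑(unionT x.1) : Set V) := by
  rw [M2_endsD_assignX_eq hF]
  obtain ⟨h1, h2, h3, h4⟩ := block_switch_data hT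
  obtain ⟨hsep, _, _⟩ := mem_RepD.1 hρ
  rw [M2_flipTouch_of_closed hsep h1 h2 h3 h4]
  have hK := unionT_subset_K2_endsD hρ hT
  ext y
  simp only [Set.mem_union, Set.mem_sdiff, Set.mem_inter_iff]
  constructor
  · rintro (⟨h, _⟩ | ⟨h, _⟩)
    · exact Or.inl h
    · exact Or.inr h
  · rintro (h | h)
    · by_cases hyT : y ∈ (↑(unionT x.1) : Set V)
      · exact Or.inr ⟨hyT, hK hyT⟩
      · exact Or.inl ⟨h, hyT⟩
    · exact Or.inr ⟨h, hK h⟩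

/-- The assignment is `Sep` in `G − D`. -/
lemma sep2_endsD_assignX {p q r s : V} {D : Finset V} {ρ : Config E} (hρ : ρ ∈ RepD ends p q r s D)
    {x : Finset (Finset V) × Finset E} (hT : x.1 ⊆ blocks ends D r s ρ)
    (hF : x.2 ⊆ Tset ends D r s) : sep2 (endsD ends D r) p q r s (assignX ends x ρ) := by
  obtain ⟨hsep, _, _⟩ := mem_RepD.1 hρ
  have h := sep2_assignC (ends := endsD ends D r) hsep hT
  rw [sep2_iff] at h ⊢
  rw [K2_endsD_assignX_eq hF, M2_endsD_assignX_eq hF]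
  exact h

/-- The assignment has no doubly reached vertex in `G − D` other than `r, s`. -/
lemma DZero_endsD_assignX {p q r s : V} {D : Finset V} {ρ : Config E} (hρ : ρ ∈ RepD ends p q r s D)
    {x : Finset (Finset V) × Finset E} (hT : x.1 ⊆ blocks ends D r s ρ)
    (hF : x.2 ⊆ Tset ends D r s) : DZero (endsD ends D r) r s (assignX ends x ρ) := by
  intro y hr hs hK hM
  rw [K2_endsD_assignX hρ hT hF] at hK
  rw [M2_endsD_assignX hρ hT hF] at hM
  obtain ⟨_, hM', _⟩ := mem_RepD.1 hρ
  rcases hM with hyM | hyT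
  · rcases hM' y hyM with rfl | rfl
    · exact hr rfl
    · exact hs rfl
  · exact hK.2 hyT

/-- The sided set of `G − D` is preserved by an assignment. -/
lemma A0_endsD_assignX {p q r s : V} {D : Finset V} {ρ : Config E} (hρ : ρ ∈ RepD ends p q r s D)
    {x : Finset (Finset V) × Finset E} (hT : x.1 ⊆ blocks ends D r s ρ)
    (hF : x.2 ⊆ Tset ends D r s) :
    A0 (endsD ends D r) r s (assignX ends x ρ) = A0 (endsD ends D r) r s ρ := by
  ext y
  simp only [mem_A0]
  rw [K2_endsD_assignX hρ hT hF, M2_endsD_assignX hρ hT hF]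
  have hK := unionT_subset_K2_endsD hρ hT
  constructor
  · rintro ⟨(⟨h, _⟩ | (h | h)), hr, hs⟩
    · exact ⟨Or.inl h, hr, hs⟩
    · exact ⟨Or.inr h, hr, hs⟩
    · exact ⟨Or.inl (hK h), hr, hs⟩
  · rintro ⟨(h | h), hr, hs⟩
    · by_cases hyT : y ∈ (↑(unionT x.1) : Set V)
      · exact ⟨Or.inr (Or.inr hyT), hr, hs⟩
      · exact ⟨Or.inl ⟨h, hyT⟩, hr, hs⟩
    · exact ⟨Or.inr (Or.inl h), hr, hs⟩

/-- The blocks are preserved by an assignment. -/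
lemma blocks_assignX {p q r s : V} {D : Finset V} {ρ : Config E} (hρ : ρ ∈ RepD ends p q r s D)
    {x : Finset (Finset V) × Finset E} (hT : x.1 ⊆ blocks ends D r s ρ)
    (hF : x.2 ⊆ Tset ends D r s) :
    blocks ends D r s (assignX ends x ρ) = blocks ends D r s ρ := by
  simp only [blocks, comps, A0_endsD_assignX hρ hT hF]

end Assign

section Edges

variable [Fintype V] [DecidableEq V] [Fintype E] [DecidableEq E]

variable {ends : E → Sym2 V}

/-- A block vertex is neither `r`, `s` nor in `D`. -/
lemma block_vertex_ne {p q r s : V} {D : Finset V} {ρ : Config E} (_hρ : ρ ∈ RepD ends p q r s D)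
    (hDr : ∀ d ∈ D, d ≠ r) (hDs : ∀ d ∈ D, d ≠ s) {C : Finset V} (hC : C ∈ blocks ends D r s ρ)
    {y : V} (hy : y ∈ C) : y ≠ r ∧ y ≠ s ∧ y ∉ D := by
  have hyA : y ∈ A0 (endsD ends D r) r s ρ := subset_A0_of_mem_comps (ends := endsD ends D r) hC hy
  obtain ⟨hU, hyr, hys⟩ := mem_A0.1 hyA
  refine ⟨hyr, hys, ?_⟩
  intro hyD
  rcases hU with h | h
  · exact not_mem_K2_endsD hyD (hDr y hyD) (hDs y hyD) ρ h
  · exact not_mem_M2_endsD hyD (hDr y hyD) (hDs y hyD) ρ h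

/-- No `T`-edge touches a union of blocks. -/
lemma Tset_not_touches_unionT {p q r s : V} {D : Finset V} {ρ : Config E}
    (hρ : ρ ∈ RepD ends p q r s D) (hDr : ∀ d ∈ D, d ≠ r) (hDs : ∀ d ∈ D, d ≠ s)
    {T : Finset (Finset V)} (hT : T ⊆ blocks ends D r s ρ) {e : E}
    (he : e ∈ Tset ends D r s) : e ∉ touches ends (↑(unionT T) : Set V) := by
  rintro ⟨y, hy, z, hyz⟩
  obtain ⟨C, hC, hyC⟩ := mem_unionT.1 (Finset.mem_coe.1 hy)
  obtain ⟨hyr, hys, hyD⟩ := block_vertex_ne hρ hDr hDs (hT hC) hyC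
  obtain ⟨d, hd, h⟩ := mem_Tset.1 he
  rcases h with h | h <;> rw [hyz, Sym2.eq_iff] at h
  · rcases h with ⟨h1, _⟩ | ⟨h1, _⟩
    · exact hyD (h1 ▸ hd)
    · exact hyr h1
  · rcases h with ⟨h1, _⟩ | ⟨h1, _⟩
    · exact hyD (h1 ▸ hd)
    · exact hys h1

/-- The value of a `T`-edge in an assignment: flipped iff it is in `x.2`. -/
lemma assignX_Tset {p q r s : V} {D : Finset V} {ρ : Config E} (hρ : ρ ∈ RepD ends p q r s D)
    (hDr : ∀ d ∈ D, d ≠ r) (hDs : ∀ d ∈ D, d ≠ s) {x : Finset (Finset V) × Finset E}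
    (hT : x.1 ⊆ blocks ends D r s ρ) {e : E} (he : e ∈ Tset ends D r s) :
    assignX ends x ρ e = (if e ∈ x.2 then !ρ e else ρ e) := by
  simp only [assignX]
  rw [flipTouch_of_notMem ends (Tset_not_touches_unionT hρ hDr hDs hT he)]
  by_cases h : e ∈ x.2
  · rw [flipF_of_mem h, if_pos h]
  · rw [flipF_of_notMem h, if_neg h]

/-- A `T`-edge of an assignment is `Y` iff it is not in `x.2`. -/
lemma assignX_Tset_eq_true_iff {p q r s : V} {D : Finset V} {ρ : Config E}
    (hρ : ρ ∈ RepD ends p q r s D) (hDr : ∀ d ∈ D, d ≠ r) (hDs : ∀ d ∈ D, d ≠ s)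
    {x : Finset (Finset V) × Finset E} (hT : x.1 ⊆ blocks ends D r s ρ) {e : E}
    (he : e ∈ Tset ends D r s) : assignX ends x ρ e = true ↔ e ∉ x.2 := by
  rw [assignX_Tset hρ hDr hDs hT he]
  obtain ⟨_, _, hY⟩ := mem_RepD.1 hρ
  have := hY e he
  by_cases h : e ∈ x.2
  · simp [h, this]
  · simp [h, this]

/-- An edge from `d ∈ D` to a block vertex is not a `T`-edge. -/
lemma not_mem_Tset_of_block {p q r s : V} {D : Finset V} {ρ : Config E}
    (hρ : ρ ∈ RepD ends p q r s D) (hDr : ∀ d ∈ D, d ≠ r) (hDs : ∀ d ∈ D, d ≠ s)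
    {C : Finset V} (hC : C ∈ blocks ends D r s ρ) {y : V} (hy : y ∈ C) {d : V} (hd : d ∈ D)
    {e : E} (he : ends e = s(d, y)) : e ∉ Tset ends D r s := by
  obtain ⟨hyr, hys, hyD⟩ := block_vertex_ne hρ hDr hDs hC hy
  intro h
  obtain ⟨d', hd', h'⟩ := mem_Tset.1 h
  rcases h' with h' | h' <;> rw [he, Sym2.eq_iff] at h'
  · rcases h' with ⟨_, h2⟩ | ⟨h1, _⟩
    · exact hyr h2
    · exact hDr d hd h1
  · rcases h' with ⟨_, h2⟩ | ⟨h1, _⟩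
    · exact hys h2
    · exact hDs d hd h1

omit [Fintype E] [DecidableEq E] in
/-- The block of a vertex of a union of blocks is in that set of blocks. -/
lemma block_mem_of_mem_unionT {D : Finset V} {r s : V} {ρ : Config E}
    {T : Finset (Finset V)} (hT : T ⊆ blocks ends D r s ρ) {C : Finset V}
    (hC : C ∈ blocks ends D r s ρ) {y : V} (hy : y ∈ C) (hyT : y ∈ unionT T) : C ∈ T := by
  obtain ⟨C', hC', hyC'⟩ := mem_unionT.1 hyT
  have h1 := eq_compIn_of_mem_comps (ends := endsD ends D r) hC hy
  have h2 := eq_compIn_of_mem_comps (ends := endsD ends D r) (hT hC') hyC'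
  rw [h1, ← h2]
  exact hC'

/-- The value of an edge from `d ∈ D` to a block vertex in an assignment: flipped iff the block
is switched. -/
lemma assignX_block_edge {p q r s : V} {D : Finset V} {ρ : Config E}
    (hρ : ρ ∈ RepD ends p q r s D) (hDr : ∀ d ∈ D, d ≠ r) (hDs : ∀ d ∈ D, d ≠ s)
    {x : Finset (Finset V) × Finset E} (hT : x.1 ⊆ blocks ends D r s ρ)
    (hF : x.2 ⊆ Tset ends D r s) {C : Finset V} (hC : C ∈ blocks ends D r s ρ) {y : V}
    (hy : y ∈ C) {d : V} (hd : d ∈ D) {e : E} (he : ends e = s(d, y)) :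
    assignX ends x ρ e = (if C ∈ x.1 then !ρ e else ρ e) := by
  have hnotT : e ∉ x.2 := fun h => not_mem_Tset_of_block hρ hDr hDs hC hy hd he (hF h)
  have hval : flipF x.2 ρ e = ρ e := flipF_of_notMem hnotT
  by_cases hCx : C ∈ x.1
  · rw [if_pos hCx, assignX, flipTouch_of_mem ends ⟨y, Finset.mem_coe.2 (mem_unionT.2 ⟨C, hCx, hy⟩), d,
      by rw [he, Sym2.eq_swap]⟩, hval]
  · rw [if_neg hCx, assignX, flipTouch_of_notMem ends, hval]
    rintro ⟨z, hz, w, hzw⟩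
    rw [he, Sym2.eq_iff] at hzw
    rcases hzw with ⟨h1, _⟩ | ⟨_, h2⟩
    · obtain ⟨C', hC', hzC'⟩ := mem_unionT.1 (Finset.mem_coe.1 hz)
      exact (block_vertex_ne hρ hDr hDs (hT hC') hzC').2.2 (h1 ▸ hd)
    · rw [← h2] at hz
      exact hCx (block_mem_of_mem_unionT hT hC hy (Finset.mem_coe.1 hz))

end Edges

end NoPocketSet

end Summit.Ventures.PercRepro2
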